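import Literature.AnabelianGeometry.SemiGraphs.TemperedReconstructionReductionsProofs
import Literature.AnabelianGeometry.SemiGraphs.TemperedEdgeLikeDistinct

/-!
# [SemiAnbd] Corollary 3.9, step (R4): uniqueness of the edge map of a compatible morphism —
# reduction to the edge analogue of Theorem 3.7 (ii)

Mochizuki, *Semi-graphs of anabelioids*, Publ. RIMS **42** (2006), §3, proof of Corollary 3.9 p. 43
("[again by Theorem 3.7, (iii), (iv)] is manifestly unique") and Theorem 3.7 (ii)–(iv) pp. 40–41
[cite: MochizukiSemiAnbd2006, Cor 3.9 p.43].  The residual named fact `CompatibleEdgeMapUnique` (R4)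
of `TemperedReconstructionReductions.lean` (abc-iut-L3-t2) — two locally open morphisms `F, F' : G → H`
compatible with the same `φ : π₁^temp(G) → π₁^temp(H)` and agreeing on vertices agree on edges — is
REDUCED here to the edge analogue of Theorem 3.7 (ii), clause 1, the named residual fact
`EdgeLikeDistinct` of `TemperedEdgeLikeDistinct.lean`: edge-like subgroups of DISTINCT edges meet with
infinite index.  (On the universal
pro-covering tree this is "`Stab(ẽ₁) ∩ Stab(ẽ₂) = 1` for `ẽ₁ ≠ ẽ₂`", total estrangement along the
geodesic — Theorem 3.7 (iii)/(iv) territory; it is not among the typed statements of Theorem 3.7 and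
is left as a named input, like `VerticialDistinct` in the vertex half `compatible_vertexMap_eq`.)

The proof transposes abc-iut-L3-t2's `compatible_vertexMap_eq` to edges: for an edge `e` of the graph
`G` pick a branch `b` at `v`; edge homomorphisms exist at `e`, `F e`, `F' e` (a verticial homomorphism
followed by `b_*` IS an edge homomorphism, abc-iut-L3-t2's `isEdgeHom_comp_brHom`) and are injective
(`VerticialInjective` + injective type; any edge homomorphism is conjugate to such a one);
compatibility on edges puts `S = φ(ψ_e(Π_e))` inside an edge-like subgroup `W₁` of `F e` with FINITE
index (`F_e` has open image) and inside an edge-like subgroup `W₂` of `F' e`; so `[W₁ : W₁ ∩ W₂] < ∞`,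
which `EdgeLikeDistinct` forbids unless `F e = F' e`.  Proof-only file.
-/

namespace Literature.AnabelianGeometry.SemiGraphs

namespace ProfiniteSemiGraph

open CategoryTheory Topology

universe u

variable {𝒢 ℋ : ProfiniteSemiGraph.{u}}

/-! ### Edge homomorphisms: existence from a verticial homomorphism, conjugates, injectivity -/

/-- **Edge homomorphisms exist and are injective** at every edge having a branch at a vertex, under
Theorem 3.7 (i) (`VerticialInjective`) and the injective type of `G`: take `φ_v ∘ b_*`.
[cite: MochizukiSemiAnbd2006, Thm 3.7(iii) p.41] -/
theorem exists_isEdgeHom_injective (h37i : VerticialInjective.{u}) (h𝒢 : 𝒢.Thm37Hypotheses)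
    (c : TemperedPiChart 𝒢) (b : 𝒢.graph.Branch) (v : 𝒢.graph.Vertex)
    (h : 𝒢.graph.abuts b = some v) :
    ∃ ψ : 𝒢.Ge (𝒢.graph.edgeOf b) →ₜ* c.G, IsEdgeHom c (𝒢.graph.edgeOf b) ψ ∧
      Function.Injective ψ := by
  obtain ⟨⟨_, φ, hφ, rfl⟩, hinj⟩ := h37i 𝒢 h𝒢 c v
  exact ⟨φ.comp (𝒢.brHom b v h), isEdgeHom_comp_brHom c h hφ,
    (hinj φ hφ).comp (h𝒢.isOfInjectiveType b v h)⟩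

/-- **Every edge homomorphism is injective** (under `VerticialInjective` and injective type): it is
conjugate (Prop. 3.2) to an injective one. [cite: MochizukiSemiAnbd2006, Thm 3.7(iii) p.41] -/
theorem injective_of_isEdgeHom (h37i : VerticialInjective.{u}) (h𝒢 : 𝒢.Thm37Hypotheses)
    (c : TemperedPiChart 𝒢) (b : 𝒢.graph.Branch) (v : 𝒢.graph.Vertex)
    (h : 𝒢.graph.abuts b = some v) (ψ : 𝒢.Ge (𝒢.graph.edgeOf b) →ₜ* c.G)
    (hψ : IsEdgeHom c (𝒢.graph.edgeOf b) ψ) : Function.Injective ψ := by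
  obtain ⟨ψ₀, ⟨i₀⟩, hinj₀⟩ := exists_isEdgeHom_injective h37i h𝒢 c b v h
  obtain ⟨i⟩ := hψ
  obtain ⟨g, hg, -⟩ := BTemp.exists_conj_of_natTrans c.isTempered ψ₀ ψ (i₀.symm ≪≫ i).hom
  intro x y hxy
  apply hinj₀
  have key : g * ψ₀ x * g⁻¹ = g * ψ₀ y * g⁻¹ := by rw [hg x, hg y, hxy]
  exact mul_left_cancel (mul_right_cancel key)

/-! ### (R4) from `EdgeLikeDistinct` -/

/-- **Uniqueness of the edge map** (p. 43 "manifestly unique", edge part), REDUCED to the edge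
analogue of Theorem 3.7 (ii) (`EdgeLikeDistinct`) and Theorem 3.7 (i) (`VerticialInjective`): if two
locally open morphisms `F, F' : G → H` are compatible with `φ` on edge homomorphisms, they agree on
edges.  For an edge `e`, `φ(ψ_e(Π_e))` lies in an edge-like subgroup `W₁` at `F e` with finite index
(the image of the OPEN subgroup `F_e(Π_e)` under the injective `γ_g ∘ ψ_{F e}`) and in an edge-like
subgroup `W₂` at `F' e`; hence `[W₁ : W₁ ∩ W₂] < ∞`, which forces `F e = F' e`.
[cite: MochizukiSemiAnbd2006, Cor 3.9 p.43] -/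
theorem CompatibleEdgeMapUnique_of (hED : EdgeLikeDistinct.{u}) (h37i : VerticialInjective.{u}) :
    CompatibleEdgeMapUnique.{u} := by
  intro 𝒢 ℋ h𝒢 hℋ c𝒢 cℋ F F' φ hF _ _ hE _ hE' _
  funext e
  -- a branch `b` of `e` at a vertex `v` (`G` is a graph)
  obtain ⟨b, -, -, hb, -, -⟩ := 𝒢.graph.two_branches e
  subst hb
  obtain ⟨v, hv⟩ := Option.isSome_iff_exists.mp (h𝒢.isGraph.abuts_isSome b)
  -- edge homomorphisms at `e`, `F e`, `F' e`
  obtain ⟨ψ, hψ, -⟩ := exists_isEdgeHom_injective h37i h𝒢.thm37Hypotheses c𝒢 b v hv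
  have h₁ := exists_isEdgeHom_injective h37i hℋ.thm37Hypotheses cℋ (F.base.branchMap b)
    (F.base.vertexMap v) (F.base.abuts_branchMap b v hv)
  rw [F.base.edgeOf_branchMap] at h₁
  obtain ⟨ψ₁, hψ₁, hinj₁⟩ := h₁
  have h₂ := exists_isEdgeHom_injective h37i hℋ.thm37Hypotheses cℋ (F'.base.branchMap b)
    (F'.base.vertexMap v) (F'.base.abuts_branchMap b v hv)
  rw [F'.base.edgeOf_branchMap] at h₂
  obtain ⟨ψ₂, hψ₂, -⟩ := h₂
  obtain ⟨g₁, hg₁⟩ := hE (𝒢.graph.edgeOf b) ψ ψ₁ hψ hψ₁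
  obtain ⟨g₂, hg₂⟩ := hE' (𝒢.graph.edgeOf b) ψ ψ₂ hψ hψ₂
  -- the three subgroups of `π₁^temp(H)`
  let S : Subgroup cℋ.G := ψ.toMonoidHom.range.map φ.toMonoidHom
  let W₁ : Subgroup cℋ.G := ψ₁.toMonoidHom.range.map (MulAut.conj g₁).toMonoidHom
  let W₂ : Subgroup cℋ.G := ψ₂.toMonoidHom.range.map (MulAut.conj g₂).toMonoidHom
  have hW₁ : W₁ ∈ edgeLikeSubgroups cℋ (F.base.edgeMap (𝒢.graph.edgeOf b)) :=
    conj_mem_edgeLikeSubgroups' cℋ ⟨ψ₁, hψ₁, rfl⟩ g₁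
  have hW₂ : W₂ ∈ edgeLikeSubgroups cℋ (F'.base.edgeMap (𝒢.graph.edgeOf b)) :=
    conj_mem_edgeLikeSubgroups' cℋ ⟨ψ₂, hψ₂, rfl⟩ g₂
  have hSW₂ : S ≤ W₂ := by
    rintro _ ⟨_, ⟨x, rfl⟩, rfl⟩
    refine ⟨ψ₂ (F'.hE _ x), ⟨F'.hE _ x, rfl⟩, ?_⟩
    change g₂ * ψ₂ (F'.hE _ x) * g₂⁻¹ = φ (ψ x)
    exact (hg₂ x).symm
  -- `S` and `W₁` through the injective `j = γ_{g₁} ∘ ψ₁`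
  let j : ℋ.Ge (F.base.edgeMap (𝒢.graph.edgeOf b)) →* cℋ.G :=
    (MulAut.conj g₁).toMonoidHom.comp ψ₁.toMonoidHom
  have hj : Function.Injective j := fun a a' haa' => hinj₁ ((MulAut.conj g₁).injective haa')
  let U : Subgroup (ℋ.Ge (F.base.edgeMap (𝒢.graph.edgeOf b))) := (F.hE _).toMonoidHom.range
  have hS : S = U.map j := by
    ext y
    constructor
    · rintro ⟨_, ⟨x, rfl⟩, rfl⟩
      exact ⟨F.hE _ x, ⟨x, rfl⟩, (hg₁ x).symm⟩
    · rintro ⟨_, ⟨x, rfl⟩, rfl⟩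
      exact ⟨ψ x, ⟨x, rfl⟩, hg₁ x⟩
  have hW₁j : W₁ = (⊤ : Subgroup (ℋ.Ge (F.base.edgeMap (𝒢.graph.edgeOf b)))).map j := by
    change (Subgroup.map _ _) = _
    rw [MonoidHom.range_eq_map, Subgroup.map_map]
  -- `S` has finite index in `W₁`: `U` is open in the profinite `Π_{F e}`
  have hU : U.index ≠ 0 := by
    haveI := Subgroup.quotient_finite_of_isOpen U (hF.2 _)
    exact Subgroup.index_ne_zero_of_finite
  have hSW₁ : S.relIndex W₁ ≠ 0 := by
    rw [hS, hW₁j, Subgroup.relIndex_map_map_of_injective _ _ hj, Subgroup.relIndex_top_right]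
    exact hU
  have hW₂W₁ : W₂.relIndex W₁ ≠ 0 := fun h0 => hSW₁ (Subgroup.relIndex_eq_zero_of_le_left hSW₂ h0)
  -- the edge analogue of Theorem 3.7 (ii), clause 1
  by_contra hne
  exact hW₂W₁ (hED ℋ hℋ.thm37Hypotheses cℋ _ _ W₁ W₂ hW₁ hW₂ hne)

end ProfiniteSemiGraph

end Literature.AnabelianGeometry.SemiGraphs
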